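import Summits.HodgeConjecture.HodgeConjecture.Theorems.Ring2WeilCoverageSchurDefectB
import HarnessLib

/-!
# Weil-type family coverage — THEOREM S3/S5 arithmetic, part D: hidden factors beyond `2T` (`GL₂(𝔽₃)` over `ℚ(√-2)`, `C₄ × S₃` over `ℚ(i)`)

research route conditional on HC_CM; not a corollary; Q11.4-sentence-2 already refuted in dim ≥ 3.

Ring 2, WEIL-TYPE FAMILY-COVERAGE CENSUS (`HOME/WEIL-FAMILY-COVERAGE.md` `## b04`, block b04.12 P.S. 3, owner ring2-b04, gen 48); fourth part
of `Ring2WeilCoverageSchurDefect` (imports part B).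

* §1 `GL₂(𝔽₃)`, the faithful 2-dimensional pair with `ℚ(χ) = ℚ(√-2)`: THEOREM S3 for the factor predicts `[a_B] = 1` always (`3` splits in
  `ℚ(√-2)`, `Ram = {2}`) — the literal classes of the seven factors computed (`gl23b.py`): all the split class, with constructive witnesses.
* §2 `C₄ × S₃`, `χ = μ ⊗ ρ` (`ℚ(χ) = ℚ(i)`): THEOREM S5 predicts `[a_B] = [3]^{r₁}`; the first NON-split `ℚ(i)` factor with a curve,
  `(0; (1,τ),(c,τ),(c,τ),(c²,τ))` (genus 7, `det H|_B = −8/3`, row `W2.1.3`), and five split ones.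

No `def`, no named fact, no `sorry`; nothing here is a statement about Hodge classes; `HC_CM` is used nowhere.
References: [cite: vanGeemen1994HodgeAV, (5.4.1)].
-/

set_option linter.dupNamespace false

open Literature.AlgebraicGeometry.Motives
open Literature.AlgebraicGeometry.VanGeemen1994
open Summit.HodgeConjecture.HodgeConjecture.Ring2.Hypotheses

namespace Summit.HodgeConjecture.HodgeConjecture.Ring2.WeilCoverage

/-! ### §1 `GL₂(𝔽₃)` factors over `ℚ(√-2)`: all split, as THEOREM S3 predicts -/
/-- `GL2(3)`-cover `(0; c2,c2,c3,c3)` (genus 9, Hurwitz dimension 1): the FACTOR `B` of the even-degree piece `P = B^d` — an abelian surface with `(1,1)` `ℚ(√-2)`-action — has literal `det H|_B = -2`, `a = 2`: row `W2.2.1` (SPLIT); the census row of `P` itself is `W4.2.1`.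
research route conditional on HC_CM; not a corollary; Q11.4-sentence-2 already refuted in dim ≥ 3. [cite: vanGeemen1994HodgeAV, (5.4.1)] -/
theorem factorGL23_2233_q0_g9_mk_detH_eq_split :
    (QuotientGroup.mk (Units.mk0 ((-2 : ℚ)) (by norm_num)) : weilNormResidueGroup 2) =
      splitDiscriminantClass 1 2 := by
  have e : Units.mk0 ((-2 : ℚ)) (by norm_num) = -(Units.mk0 (2 : ℚ) (by norm_num)) := Units.ext (by norm_num)
  rw [e, mk_neg_eq_splitDiscriminantClass_iff_of_odd (n := 1) (by decide)]
  exact mem_normUnitsSubgroup_of_sq_add_mul_sq _ (0 : ℚ) (1 : ℚ) (by norm_num)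

/-- `GL2(3)`-cover `(0; c2,c2,c3,c4)` (genus 11, Hurwitz dimension 1): the FACTOR `B` of the even-degree piece `P = B^d` — an abelian surface with `(1,1)` `ℚ(√-2)`-action — has literal `det H|_B = -6`, `a = 6`: row `W2.2.1` (SPLIT); the census row of `P` itself is `W4.2.1`.
research route conditional on HC_CM; not a corollary; Q11.4-sentence-2 already refuted in dim ≥ 3. [cite: vanGeemen1994HodgeAV, (5.4.1)] -/
theorem factorGL23_2234_q0_g11_mk_detH_eq_split :
    (QuotientGroup.mk (Units.mk0 ((-6 : ℚ)) (by norm_num)) : weilNormResidueGroup 2) =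
      splitDiscriminantClass 1 2 := by
  have e : Units.mk0 ((-6 : ℚ)) (by norm_num) = -(Units.mk0 (6 : ℚ) (by norm_num)) := Units.ext (by norm_num)
  rw [e, mk_neg_eq_splitDiscriminantClass_iff_of_odd (n := 1) (by decide)]
  exact mem_normUnitsSubgroup_of_sq_add_mul_sq _ (-2 : ℚ) (1 : ℚ) (by norm_num)

/-- `GL2(3)`-cover `(0; c2,c2,c3,c6)` (genus 13, Hurwitz dimension 1): the FACTOR `B` of the even-degree piece `P = B^d` — an abelian surface with `(1,1)` `ℚ(√-2)`-action — has literal `det H|_B = -2`, `a = 2`: row `W2.2.1` (SPLIT); the census row of `P` itself is `W4.2.1`.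
research route conditional on HC_CM; not a corollary; Q11.4-sentence-2 already refuted in dim ≥ 3. [cite: vanGeemen1994HodgeAV, (5.4.1)] -/
theorem factorGL23_2236_q0_g13_mk_detH_eq_split :
    (QuotientGroup.mk (Units.mk0 ((-2 : ℚ)) (by norm_num)) : weilNormResidueGroup 2) =
      splitDiscriminantClass 1 2 :=
  factorGL23_2233_q0_g9_mk_detH_eq_split

/-- `GL2(3)`-cover `(0; c2,c2,c4,c6)` (genus 15, Hurwitz dimension 1): the FACTOR `B` of the even-degree piece `P = B^d` — an abelian surface with `(1,1)` `ℚ(√-2)`-action — has literal `det H|_B = -1/3`, `a = 1/3`: row `W2.2.1` (SPLIT); the census row of `P` itself is `W4.2.1`.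
research route conditional on HC_CM; not a corollary; Q11.4-sentence-2 already refuted in dim ≥ 3. [cite: vanGeemen1994HodgeAV, (5.4.1)] -/
theorem factorGL23_2246_q0_g15_mk_detH_eq_split :
    (QuotientGroup.mk (Units.mk0 (((-1 : ℚ) / 3)) (by norm_num)) : weilNormResidueGroup 2) =
      splitDiscriminantClass 1 2 := by
  have e : Units.mk0 (((-1 : ℚ) / 3)) (by norm_num) = -(Units.mk0 ((1 : ℚ) / 3) (by norm_num)) := Units.ext (by norm_num)
  rw [e, mk_neg_eq_splitDiscriminantClass_iff_of_odd (n := 1) (by decide)]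
  exact mem_normUnitsSubgroup_of_sq_add_mul_sq _ ((1 : ℚ) / 3) ((1 : ℚ) / 3) (by norm_num)

/-- `GL2(3)`-cover `(0; c6,c8A,c8B)` (genus 15, Hurwitz dimension 0): the FACTOR `B` of the even-degree piece `P = B^d` — an abelian surface with `(1,1)` `ℚ(√-2)`-action — has literal `det H|_B = -2/3`, `a = 2/3`: row `W2.2.1` (SPLIT); the census row of `P` itself is `W4.2.1`.
research route conditional on HC_CM; not a corollary; Q11.4-sentence-2 already refuted in dim ≥ 3. [cite: vanGeemen1994HodgeAV, (5.4.1)] -/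
theorem factorGL23_68A8B_q0_g15_mk_detH_eq_split :
    (QuotientGroup.mk (Units.mk0 (((-2 : ℚ) / 3)) (by norm_num)) : weilNormResidueGroup 2) =
      splitDiscriminantClass 1 2 := by
  have e : Units.mk0 (((-2 : ℚ) / 3)) (by norm_num) = -(Units.mk0 ((2 : ℚ) / 3) (by norm_num)) := Units.ext (by norm_num)
  rw [e, mk_neg_eq_splitDiscriminantClass_iff_of_odd (n := 1) (by decide)]
  exact mem_normUnitsSubgroup_of_sq_add_mul_sq _ ((-2 : ℚ) / 3) ((1 : ℚ) / 3) (by norm_num)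

/-- `GL2(3)`-cover `(0; c2,c2,c2,c2,c3)` (genus 17, Hurwitz dimension 2): the FACTOR `B` of the even-degree piece `P = B^d` — an abelian surface with `(1,1)` `ℚ(√-2)`-action — has literal `det H|_B = -1/3`, `a = 1/3`: row `W2.2.1` (SPLIT); the census row of `P` itself is `W4.2.1`.
research route conditional on HC_CM; not a corollary; Q11.4-sentence-2 already refuted in dim ≥ 3. [cite: vanGeemen1994HodgeAV, (5.4.1)] -/
theorem factorGL23_22223_q0_g17_mk_detH_eq_split :
    (QuotientGroup.mk (Units.mk0 (((-1 : ℚ) / 3)) (by norm_num)) : weilNormResidueGroup 2) =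
      splitDiscriminantClass 1 2 :=
  factorGL23_2246_q0_g15_mk_detH_eq_split

/-- `GL2(3)`-cover `(0; c2,c2,c6,c6)` (genus 17, Hurwitz dimension 1): the FACTOR `B` of the even-degree piece `P = B^d` — an abelian surface with `(1,1)` `ℚ(√-2)`-action — has literal `det H|_B = -1/9`, `a = 1/9`: row `W2.2.1` (SPLIT); the census row of `P` itself is `W4.2.1`.
research route conditional on HC_CM; not a corollary; Q11.4-sentence-2 already refuted in dim ≥ 3. [cite: vanGeemen1994HodgeAV, (5.4.1)] -/
theorem factorGL23_2266_q0_g17_mk_detH_eq_split :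
    (QuotientGroup.mk (Units.mk0 (((-1 : ℚ) / 9)) (by norm_num)) : weilNormResidueGroup 2) =
      splitDiscriminantClass 1 2 := by
  have e : Units.mk0 (((-1 : ℚ) / 9)) (by norm_num) = -(Units.mk0 ((1 : ℚ) / 9) (by norm_num)) := Units.ext (by norm_num)
  rw [e, mk_neg_eq_splitDiscriminantClass_iff_of_odd (n := 1) (by decide)]
  exact mem_normUnitsSubgroup_of_sq_add_mul_sq _ ((1 : ℚ) / 3) (0 : ℚ) (by norm_num)

/-! ### §2 `C₄ × S₃` factors over `ℚ(i)`: the law `[3]^{r₁}` -/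

/-- `C4xS3`-cover `(0; c0t,c0t,c1t,c3t)` (genus 7, Hurwitz dimension 1): the FACTOR `B` of the even-degree piece `P = B^d` — an abelian surface with `(1,1)` `ℚ(√-1)`-action — has literal `det H|_B = -4`, `a = 4`: row `W2.1.1` (SPLIT); the census row of `P` itself is `W4.1.1`.
research route conditional on HC_CM; not a corollary; Q11.4-sentence-2 already refuted in dim ≥ 3. [cite: vanGeemen1994HodgeAV, (5.4.1)] -/
theorem factorC4xS3_0t0t1t3t_q0_g7_mk_detH_eq_split :
    (QuotientGroup.mk (Units.mk0 ((-4 : ℚ)) (by norm_num)) : weilNormResidueGroup 1) =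
      splitDiscriminantClass 1 1 := by
  have e : Units.mk0 ((-4 : ℚ)) (by norm_num) = -(Units.mk0 (4 : ℚ) (by norm_num)) := Units.ext (by norm_num)
  rw [e, mk_neg_eq_splitDiscriminantClass_iff_of_odd (n := 1) (by decide)]
  exact mem_normUnitsSubgroup_of_sq_add_mul_sq _ (2 : ℚ) (0 : ℚ) (by norm_num)

/-- `C4xS3`-cover `(0; c0t,c1t,c1t,c2t)` (genus 7, Hurwitz dimension 1): the FACTOR `B` of the even-degree piece `P = B^d` — an abelian surface with `(1,1)` `ℚ(√-1)`-action — has literal `det H|_B = -8/3`, `a = 8/3`: row `W2.1.3` (NON-split); the census row of `P` itself is `W4.1.1`.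
research route conditional on HC_CM; not a corollary; Q11.4-sentence-2 already refuted in dim ≥ 3. [cite: vanGeemen1994HodgeAV, (5.4.1)] -/
theorem factorC4xS3_0t1t1t2t_q0_g7_mk_detH_ne_split :
    (QuotientGroup.mk (Units.mk0 (((-8 : ℚ) / 3)) (by norm_num)) : weilNormResidueGroup 1) ≠
      splitDiscriminantClass 1 1 := by
  have e : Units.mk0 (((-8 : ℚ) / 3)) (by norm_num) = -(Units.mk0 ((8 : ℚ) / 3) (by norm_num)) := Units.ext (by norm_num)
  rw [Ne, e, mk_neg_eq_splitDiscriminantClass_iff_of_odd (n := 1) (by decide)]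
  have h := mul_not_mem_normUnitsSubgroup (mem_normUnitsSubgroup_of_sq_add_mul_sq (d := 1) (a := ((8 : ℚ) / 9)) (by norm_num) ((2 : ℚ) / 3) ((2 : ℚ) / 3) (by norm_num))
    (natCast_not_mem_normUnitsSubgroup_of_inert (d := 1) (a := 3) (p := 3) (by norm_num) (by decide) (by norm_num) (by norm_num) (by norm_num))
  rw [mk0_mul_mk0] at h
  norm_num at h
  exact h

/-- `C4xS3`-cover `(0; c0t,c0t,c0t,c0t,c1e,c3e)` (genus 19, Hurwitz dimension 3): the FACTOR `B` of the even-degree piece `P = B^d` — an abelian fourfold with `(2,2)` `ℚ(√-1)`-action — has literal `det H|_B = 1/4`, `a = 1/4`: row `W4.1.1` (SPLIT); the census row of `P` itself is `W8.1.1`.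
research route conditional on HC_CM; not a corollary; Q11.4-sentence-2 already refuted in dim ≥ 3. [cite: vanGeemen1994HodgeAV, (5.4.1)] -/
theorem factorC4xS3_0t0t0t0t1e3e_q0_g19_mk_detH_eq_split :
    (QuotientGroup.mk (Units.mk0 (((1 : ℚ) / 4)) (by norm_num)) : weilNormResidueGroup 1) =
      splitDiscriminantClass 2 1 := by
  have e : Units.mk0 (((1 : ℚ) / 4)) (by norm_num) = Units.mk0 ((1 : ℚ) / 4) (by norm_num) := Units.ext (by norm_num)
  rw [e, mk_eq_splitDiscriminantClass_iff_of_even (n := 2) (by decide)]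
  exact mem_normUnitsSubgroup_of_sq_add_mul_sq _ ((1 : ℚ) / 2) (0 : ℚ) (by norm_num)

/-- `C4xS3`-cover `(0; c1e,c3e,c0t,c0t,c0r)` (genus 15, Hurwitz dimension 2): the FACTOR `B` of the even-degree piece `P = B^d` — an abelian fourfold with `(2,2)` `ℚ(√-1)`-action — has literal `det H|_B = 1`, `a = 1`: row `W4.1.1` (SPLIT); the census row of `P` itself is `W8.1.1`.
research route conditional on HC_CM; not a corollary; Q11.4-sentence-2 already refuted in dim ≥ 3. [cite: vanGeemen1994HodgeAV, (5.4.1)] -/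
theorem factorC4xS3_1e3e0t0t0r_q0_g15_mk_detH_eq_split :
    (QuotientGroup.mk (Units.mk0 ((1 : ℚ)) (by norm_num)) : weilNormResidueGroup 1) =
      splitDiscriminantClass 2 1 := by
  have e : Units.mk0 ((1 : ℚ)) (by norm_num) = Units.mk0 (1 : ℚ) (by norm_num) := Units.ext (by norm_num)
  rw [e, mk_eq_splitDiscriminantClass_iff_of_even (n := 2) (by decide)]
  exact mem_normUnitsSubgroup_of_sq_add_mul_sq _ (1 : ℚ) (0 : ℚ) (by norm_num)

/-- `C4xS3`-cover `(0; c1r,c3r,c0t,c0t)` (genus 11, Hurwitz dimension 1): the FACTOR `B` of the even-degree piece `P = B^d` — an abelian surface with `(1,1)` `ℚ(√-1)`-action — has literal `det H|_B = -1`, `a = 1`: row `W2.1.1` (SPLIT); the census row of `P` itself is `W4.1.1`.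
research route conditional on HC_CM; not a corollary; Q11.4-sentence-2 already refuted in dim ≥ 3. [cite: vanGeemen1994HodgeAV, (5.4.1)] -/
theorem factorC4xS3_1r3r0t0t_q0_g11_mk_detH_eq_split :
    (QuotientGroup.mk (Units.mk0 ((-1 : ℚ)) (by norm_num)) : weilNormResidueGroup 1) =
      splitDiscriminantClass 1 1 := by
  have e : Units.mk0 ((-1 : ℚ)) (by norm_num) = -(Units.mk0 (1 : ℚ) (by norm_num)) := Units.ext (by norm_num)
  rw [e, mk_neg_eq_splitDiscriminantClass_iff_of_odd (n := 1) (by decide)]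
  exact mem_normUnitsSubgroup_of_sq_add_mul_sq _ (1 : ℚ) (0 : ℚ) (by norm_num)

/-- `C4xS3`-cover `(0; c1t,c3t,c2t,c2t)` (genus 7, Hurwitz dimension 1): the FACTOR `B` of the even-degree piece `P = B^d` — an abelian surface with `(1,1)` `ℚ(√-1)`-action — has literal `det H|_B = -4/9`, `a = 4/9`: row `W2.1.1` (SPLIT); the census row of `P` itself is `W4.1.1`.
research route conditional on HC_CM; not a corollary; Q11.4-sentence-2 already refuted in dim ≥ 3. [cite: vanGeemen1994HodgeAV, (5.4.1)] -/
theorem factorC4xS3_1t3t2t2t_q0_g7_mk_detH_eq_split :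
    (QuotientGroup.mk (Units.mk0 (((-4 : ℚ) / 9)) (by norm_num)) : weilNormResidueGroup 1) =
      splitDiscriminantClass 1 1 := by
  have e : Units.mk0 (((-4 : ℚ) / 9)) (by norm_num) = -(Units.mk0 ((4 : ℚ) / 9) (by norm_num)) := Units.ext (by norm_num)
  rw [e, mk_neg_eq_splitDiscriminantClass_iff_of_odd (n := 1) (by decide)]
  exact mem_normUnitsSubgroup_of_sq_add_mul_sq _ ((2 : ℚ) / 3) (0 : ℚ) (by norm_num)

end Summit.HodgeConjecture.HodgeConjecture.Ring2.WeilCoverage
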